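import Mathlib
import Literature.MathematicalPhysics.KineticTheory.InfiniteChainObservables
import HarnessLib

/-!
# Cesàro upgrade, helper 1: polynomial growth in a box and integrability from site moments

Support file for item `stmt-AtomisticToContinuum-13981` (`ParityLiouvilleSeed.CesaroUpgrade`,
`ZeroCurrentRigidity → LiouvilleForHeat`).

Every observable met in the Cesàro-averaging argument (coordinates, forces, bond currents, `𝒜f`
for local test functions `f`, cut-off site energies) is continuous on `ChainConfig = ℤ → ℝ × ℝ`
and bounded by `K (1 + ‖box_R σ‖) ^ d` for some centred box `{-R, …, R}` (`boxRestrict R`, sup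
norm). This file proves:

* `one_add_norm_boxRestrict_pow_le` — `(1 + ‖box_R σ‖)^d ≤ 2^d (1 + ∑_{|x| ≤ R} (|q_x|^d + |p_x|^d))`,
  so growth bounds are integrable as soon as the site moments of order `d` are
  (`integrable_of_abs_le_growth`, with the explicit bound `K 2^d (1 + (2R+1) C)` on `∫ |Φ|`);
* explicit derivatives, continuity and growth of the force and of the bond current of
  `pinnedChain ω₂ lam β γ` (any real parameters), and continuity + cubic growth of `𝒜f` for
  `f ∈ C₀¹`.

No new definitions (growth bounds are written out).
-/

noncomputable section

namespace Summit.AtomisticToContinuum.FouriersLaw.Theorems.CesaroUpgrade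

open MeasureTheory Filter Topology Set
open Literature.MathematicalPhysics.KineticTheory.HeatConduction

/-! ### Coordinates are dominated by the box norm -/

/-- The box restriction is continuous (product topology). [folklore] -/
@[fun_prop]
theorem continuous_boxRestrict (R : ℕ) : Continuous (boxRestrict R) :=
  continuous_pi fun _ => continuous_apply _

/-- The box restriction to `{a, …, a+n}` is continuous. [folklore] -/
@[fun_prop]
theorem continuous_boxRestrictAt (a : ℤ) (n : ℕ) : Continuous (boxRestrictAt a n) :=
  continuous_pi fun _ => continuous_apply _

/-- The shift is continuous. [folklore] -/
@[fun_prop]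
theorem continuous_shift : Continuous shift :=
  continuous_pi fun _ => continuous_apply _

/-- A site `x` with `|x| ≤ R` is a coordinate of the centred box: `‖σ x‖ ≤ ‖box_R σ‖`. [folklore] -/
theorem norm_apply_le_norm_boxRestrict {R : ℕ} {x : ℤ} (hx : |x| ≤ R) (σ : ChainConfig) :
    ‖σ x‖ ≤ ‖boxRestrict R σ‖ := by
  have hx' := abs_le.mp hx
  let i : Fin (2 * R + 1) := ⟨(x + R).toNat, by omega⟩
  have hi : ((i : ℕ) : ℤ) - R = x := by
    simp only [i]
    omega
  have h := norm_le_pi_norm (boxRestrict R σ) i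
  rwa [boxRestrict_apply, hi] at h

/-- `|q_x| ≤ ‖box_R σ‖` for `|x| ≤ R`. [folklore] -/
theorem abs_fst_le_norm_boxRestrict {R : ℕ} {x : ℤ} (hx : |x| ≤ R) (σ : ChainConfig) :
    |(σ x).1| ≤ ‖boxRestrict R σ‖ :=
  le_trans (by rw [← Real.norm_eq_abs]; exact norm_fst_le (σ x)) (norm_apply_le_norm_boxRestrict hx σ)

/-- `|p_x| ≤ ‖box_R σ‖` for `|x| ≤ R`. [folklore] -/
theorem abs_snd_le_norm_boxRestrict {R : ℕ} {x : ℤ} (hx : |x| ≤ R) (σ : ChainConfig) :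
    |(σ x).2| ≤ ‖boxRestrict R σ‖ :=
  le_trans (by rw [← Real.norm_eq_abs]; exact norm_snd_le (σ x)) (norm_apply_le_norm_boxRestrict hx σ)

/-- The box norm is monotone in the box. [folklore] -/
theorem norm_boxRestrict_mono {R R' : ℕ} (h : R ≤ R') (σ : ChainConfig) :
    ‖boxRestrict R σ‖ ≤ ‖boxRestrict R' σ‖ := by
  refine (pi_norm_le_iff_of_nonneg (norm_nonneg _)).mpr fun i => ?_
  rw [boxRestrict_apply]
  refine norm_apply_le_norm_boxRestrict ?_ σ
  have := i.isLt
  rw [abs_le]; constructor <;> omega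

/-! ### The growth weight `(1 + ‖box_R σ‖)^d` is integrable from site moments of order `d` -/

/-- `‖box_R σ‖ ^ d ≤ ∑_{i} (|q_{i-R}|^d + |p_{i-R}|^d)`. [folklore] -/
theorem norm_boxRestrict_pow_le (R d : ℕ) (σ : ChainConfig) :
    ‖boxRestrict R σ‖ ^ d ≤
      ∑ i : Fin (2 * R + 1), (|(σ ((i : ℤ) - R)).1| ^ d + |(σ ((i : ℤ) - R)).2| ^ d) := by
  obtain ⟨i, -, hi⟩ := Finset.exists_mem_eq_sup (Finset.univ : Finset (Fin (2 * R + 1)))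
    Finset.univ_nonempty (fun b => ‖boxRestrict R σ b‖₊)
  have hnorm : ‖boxRestrict R σ‖ = ‖boxRestrict R σ i‖ := by
    rw [Pi.norm_def, hi, coe_nnnorm]
  have hterm : ∀ j : Fin (2 * R + 1),
      0 ≤ |(σ ((j : ℤ) - R)).1| ^ d + |(σ ((j : ℤ) - R)).2| ^ d := fun j => by positivity
  refine le_trans ?_ (Finset.single_le_sum (fun j _ => hterm j) (Finset.mem_univ i))
  rw [hnorm, boxRestrict_apply, Prod.norm_def, Real.norm_eq_abs, Real.norm_eq_abs]
  rcases le_total |(σ ((i : ℤ) - R)).1| |(σ ((i : ℤ) - R)).2| with h | h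
  · rw [max_eq_right h]
    exact le_add_of_nonneg_left (by positivity)
  · rw [max_eq_left h]
    exact le_add_of_nonneg_right (by positivity)

/-- `(1 + ‖box_R σ‖)^d ≤ 2^d (1 + ∑_i (|q_{i-R}|^d + |p_{i-R}|^d))`. [folklore] -/
theorem one_add_norm_boxRestrict_pow_le (R d : ℕ) (σ : ChainConfig) :
    (1 + ‖boxRestrict R σ‖) ^ d ≤
      2 ^ d * (1 + ∑ i : Fin (2 * R + 1), (|(σ ((i : ℤ) - R)).1| ^ d + |(σ ((i : ℤ) - R)).2| ^ d)) := by
  set a : ℝ := ‖boxRestrict R σ‖ with ha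
  have ha0 : 0 ≤ a := norm_nonneg _
  have h1 : 1 + a ≤ 2 * max 1 a := by
    rcases le_total 1 a with h | h
    · rw [max_eq_right h]; linarith
    · rw [max_eq_left h]; linarith
  have h2 : (max 1 a) ^ d ≤ 1 + a ^ d := by
    rcases le_total 1 a with h | h
    · rw [max_eq_right h]; linarith
    · rw [max_eq_left h, one_pow]; linarith [pow_nonneg ha0 d]
  calc (1 + a) ^ d ≤ (2 * max 1 a) ^ d := by gcongr
    _ = 2 ^ d * (max 1 a) ^ d := by rw [mul_pow]
    _ ≤ 2 ^ d * (1 + a ^ d) := by gcongr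
    _ ≤ 2 ^ d * (1 + ∑ i : Fin (2 * R + 1),
          (|(σ ((i : ℤ) - R)).1| ^ d + |(σ ((i : ℤ) - R)).2| ^ d)) := by
        gcongr
        exact norm_boxRestrict_pow_le R d σ

/-- The growth weight is continuous. [folklore] -/
@[fun_prop]
theorem continuous_one_add_norm_boxRestrict_pow (R d : ℕ) :
    Continuous fun σ : ChainConfig => (1 + ‖boxRestrict R σ‖) ^ d := by
  fun_prop

/-- **Integrability of the growth weight from site moments of order `d`**: if every site has
`∫ (|q_x|^d + |p_x|^d) dν ≤ C`, then `∫ (1 + ‖box_R σ‖)^d dν ≤ 2^d (1 + (2R+1) C)`. [folklore] -/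
theorem integrable_one_add_norm_boxRestrict_pow {ν : Measure ChainConfig} [IsProbabilityMeasure ν]
    (R d : ℕ) {C : ℝ}
    (hmom : ∀ x : ℤ, Integrable (fun σ : ChainConfig => |(σ x).1| ^ d + |(σ x).2| ^ d) ν ∧
      ∫ σ, (|(σ x).1| ^ d + |(σ x).2| ^ d) ∂ν ≤ C) :
    Integrable (fun σ : ChainConfig => (1 + ‖boxRestrict R σ‖) ^ d) ν ∧
      ∫ σ, (1 + ‖boxRestrict R σ‖) ^ d ∂ν ≤ 2 ^ d * (1 + (2 * R + 1) * C) := by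
  set G : ChainConfig → ℝ := fun σ => 2 ^ d * (1 + ∑ i : Fin (2 * R + 1),
      (|(σ ((i : ℤ) - R)).1| ^ d + |(σ ((i : ℤ) - R)).2| ^ d)) with hG
  have hsum : Integrable (fun σ : ChainConfig => ∑ i : Fin (2 * R + 1),
      (|(σ ((i : ℤ) - R)).1| ^ d + |(σ ((i : ℤ) - R)).2| ^ d)) ν :=
    integrable_finsetSum _ fun i _ => (hmom _).1
  have hGint : Integrable G ν := ((integrable_const 1).add hsum).const_mul _
  have hle : ∀ σ, (1 + ‖boxRestrict R σ‖) ^ d ≤ G σ := one_add_norm_boxRestrict_pow_le R d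
  have hint : Integrable (fun σ : ChainConfig => (1 + ‖boxRestrict R σ‖) ^ d) ν := by
    refine hGint.mono' (continuous_one_add_norm_boxRestrict_pow R d).aestronglyMeasurable
      (Eventually.of_forall fun σ => ?_)
    rw [Real.norm_eq_abs, abs_of_nonneg (by positivity)]
    exact hle σ
  refine ⟨hint, ?_⟩
  calc ∫ σ, (1 + ‖boxRestrict R σ‖) ^ d ∂ν ≤ ∫ σ, G σ ∂ν := integral_mono hint hGint hle
    _ = 2 ^ d * (1 + ∑ i : Fin (2 * R + 1),
          ∫ σ, (|(σ ((i : ℤ) - R)).1| ^ d + |(σ ((i : ℤ) - R)).2| ^ d) ∂ν) := by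
        rw [hG, integral_const_mul, integral_add (integrable_const _) hsum, integral_const,
          integral_finsetSum _ fun i _ => (hmom _).1]
        simp
    _ ≤ 2 ^ d * (1 + ∑ _i : Fin (2 * R + 1), C) := by
        gcongr with i
        exact (hmom _).2
    _ = 2 ^ d * (1 + (2 * R + 1) * C) := by
        rw [Finset.sum_const, Finset.card_univ, Fintype.card_fin, nsmul_eq_mul]
        push_cast
        ring

/-- **Integrability from a growth bound**: `|Φ| ≤ K (1 + ‖box_R‖)^d` and site moments of order
`d` bounded by `C` give `Φ ∈ L¹(ν)` with `∫ |Φ| dν ≤ K 2^d (1 + (2R+1) C)`. [folklore] -/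
theorem integrable_of_abs_le_growth {ν : Measure ChainConfig} [IsProbabilityMeasure ν]
    {Φ : ChainConfig → ℝ} {R d : ℕ} {K C : ℝ}
    (hΦ : ∀ σ, |Φ σ| ≤ K * (1 + ‖boxRestrict R σ‖) ^ d) (hmeas : AEStronglyMeasurable Φ ν)
    (hmom : ∀ x : ℤ, Integrable (fun σ : ChainConfig => |(σ x).1| ^ d + |(σ x).2| ^ d) ν ∧
      ∫ σ, (|(σ x).1| ^ d + |(σ x).2| ^ d) ∂ν ≤ C) :
    Integrable Φ ν ∧ ∫ σ, |Φ σ| ∂ν ≤ K * (2 ^ d * (1 + (2 * R + 1) * C)) := by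
  obtain ⟨hw, hwle⟩ := integrable_one_add_norm_boxRestrict_pow R d hmom (ν := ν)
  have hK : 0 ≤ K := by
    have h := hΦ (fun _ => (0, 0))
    have h1 : (0 : ℝ) < (1 + ‖boxRestrict R (fun _ : ℤ => ((0 : ℝ), (0 : ℝ)))‖) ^ d := by positivity
    nlinarith [abs_nonneg (Φ fun _ => (0, 0))]
  have hint : Integrable Φ ν :=
    (hw.const_mul K).mono' hmeas (Eventually.of_forall fun σ => by
      rw [Real.norm_eq_abs]; exact hΦ σ)
  refine ⟨hint, ?_⟩
  calc ∫ σ, |Φ σ| ∂ν ≤ ∫ σ, K * (1 + ‖boxRestrict R σ‖) ^ d ∂ν :=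
        integral_mono hint.abs (hw.const_mul K) hΦ
    _ = K * ∫ σ, (1 + ‖boxRestrict R σ‖) ^ d ∂ν := integral_const_mul _ _
    _ ≤ K * (2 ^ d * (1 + (2 * R + 1) * C)) := mul_le_mul_of_nonneg_left hwle hK

/-! ### The pinned chain: derivatives, continuity and growth of forces and currents -/

section PinnedChain

variable (ω₂ lam β γ : ℝ)

/-- `U'(q) = ω₂ q + lam q³` for the pinned chain. [folklore] -/
theorem pinnedChain_deriv_U (q : ℝ) :
    deriv (pinnedChain ω₂ lam β γ).U q = ω₂ * q + lam * q ^ 3 := by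
  have h1 : HasDerivAt (fun q : ℝ => q ^ 2) (2 * q) q := by simpa using hasDerivAt_pow 2 q
  have h2 : HasDerivAt (fun q : ℝ => q ^ 4) (4 * q ^ 3) q := by simpa using hasDerivAt_pow 4 q
  have h : HasDerivAt (fun q : ℝ => ω₂ * q ^ 2 / 2 + lam * q ^ 4 / 4)
      (ω₂ * (2 * q) / 2 + lam * (4 * q ^ 3) / 4) q :=
    ((h1.const_mul ω₂).div_const 2).add ((h2.const_mul lam).div_const 4)
  rw [show (pinnedChain ω₂ lam β γ).U = fun q => ω₂ * q ^ 2 / 2 + lam * q ^ 4 / 4 from rfl, h.deriv]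
  ring

/-- `V'(r) = r + β r³` for the pinned chain. [folklore] -/
theorem pinnedChain_deriv_V (r : ℝ) :
    deriv (pinnedChain ω₂ lam β γ).V r = r + β * r ^ 3 := by
  have h1 : HasDerivAt (fun r : ℝ => r ^ 2) (2 * r) r := by simpa using hasDerivAt_pow 2 r
  have h2 : HasDerivAt (fun r : ℝ => r ^ 4) (4 * r ^ 3) r := by simpa using hasDerivAt_pow 4 r
  have h : HasDerivAt (fun r : ℝ => r ^ 2 / 2 + β * r ^ 4 / 4)
      (2 * r / 2 + β * (4 * r ^ 3) / 4) r :=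
    (h1.div_const 2).add ((h2.const_mul β).div_const 4)
  rw [show (pinnedChain ω₂ lam β γ).V = fun r => r ^ 2 / 2 + β * r ^ 4 / 4 from rfl, h.deriv]
  ring

/-- The force of the pinned chain, written out. [folklore] -/
theorem pinnedChain_force_eq (σ : ChainConfig) (x : ℤ) :
    (pinnedChain ω₂ lam β γ).force σ x =
      -(ω₂ * (σ x).1 + lam * (σ x).1 ^ 3) +
        (((σ (x + 1)).1 - (σ x).1) + β * ((σ (x + 1)).1 - (σ x).1) ^ 3) -
        (((σ x).1 - (σ (x - 1)).1) + β * ((σ x).1 - (σ (x - 1)).1) ^ 3) := by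
  rw [OscillatorChain.force_eq, pinnedChain_deriv_U, pinnedChain_deriv_V, pinnedChain_deriv_V]

/-- The bond current of the pinned chain, written out. [folklore] -/
theorem pinnedChain_bondCurrentZ_eq (σ : ChainConfig) (x : ℤ) :
    (pinnedChain ω₂ lam β γ).bondCurrentZ σ x =
      -(((σ x).2 + (σ (x + 1)).2) / 2 *
        (((σ (x + 1)).1 - (σ x).1) + β * ((σ (x + 1)).1 - (σ x).1) ^ 3)) := by
  rw [OscillatorChain.bondCurrentZ, pinnedChain_deriv_V]

/-- The force of the pinned chain is continuous in the configuration. [folklore] -/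
@[fun_prop]
theorem continuous_pinnedChain_force (x : ℤ) :
    Continuous fun σ : ChainConfig => (pinnedChain ω₂ lam β γ).force σ x := by
  simp only [pinnedChain_force_eq]
  fun_prop

/-- The bond current of the pinned chain is continuous in the configuration. [folklore] -/
@[fun_prop]
theorem continuous_pinnedChain_bondCurrentZ (x : ℤ) :
    Continuous fun σ : ChainConfig => (pinnedChain ω₂ lam β γ).bondCurrentZ σ x := by
  simp only [pinnedChain_bondCurrentZ_eq]
  fun_prop

/-- Cubic bound for `V'` on differences of box coordinates: `|V'(a - b)| ≤ (2 + 8|β|) S³` when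
`|a|, |b| ≤ S - 1`... stated with `S = 1 + M`, `|a|, |b| ≤ M`. [folklore] -/
theorem abs_pinnedChain_deriv_V_sub_le {a b M : ℝ} (hM : 0 ≤ M) (ha : |a| ≤ M) (hb : |b| ≤ M) :
    |(a - b) + β * (a - b) ^ 3| ≤ (2 + 8 * |β|) * (1 + M) ^ 3 := by
  have hab : |a - b| ≤ 2 * (1 + M) := by
    have := abs_sub a b
    linarith
  have h1M : (1 : ℝ) ≤ 1 + M := by linarith
  have hS3 : (1 + M) ≤ (1 + M) ^ 3 := by
    calc (1 + M) = (1 + M) ^ 1 := (pow_one _).symm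
      _ ≤ (1 + M) ^ 3 := pow_le_pow_right₀ h1M (by norm_num)
  calc |(a - b) + β * (a - b) ^ 3| ≤ |a - b| + |β| * |a - b| ^ 3 := by
        refine (abs_add_le _ _).trans ?_
        rw [abs_mul, abs_pow]
    _ ≤ 2 * (1 + M) + |β| * (2 * (1 + M)) ^ 3 := by
        gcongr
    _ = 2 * (1 + M) + 8 * |β| * (1 + M) ^ 3 := by ring
    _ ≤ 2 * (1 + M) ^ 3 + 8 * |β| * (1 + M) ^ 3 := by
        gcongr
    _ = (2 + 8 * |β|) * (1 + M) ^ 3 := by ring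

/-- **Cubic growth of the force** in the box `{-R, …, R}` containing `x - 1, x, x + 1`:
`|F_x(σ)| ≤ (|ω₂| + |lam| + 4 + 16|β|) (1 + ‖box_R σ‖)³`. [folklore] -/
theorem abs_pinnedChain_force_le {R : ℕ} {x : ℤ} (hx : |x| + 1 ≤ R) (σ : ChainConfig) :
    |(pinnedChain ω₂ lam β γ).force σ x| ≤
      (|ω₂| + |lam| + 4 + 16 * |β|) * (1 + ‖boxRestrict R σ‖) ^ 3 := by
  set M : ℝ := ‖boxRestrict R σ‖ with hMdef
  have hM : 0 ≤ M := norm_nonneg _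
  have hx0 : |x| ≤ R := by linarith [abs_nonneg x]
  have hx1 : |x + 1| ≤ R := by
    have := abs_add_le x 1; rw [abs_one] at this
    linarith
  have hxm1 : |x - 1| ≤ R := by
    have := abs_sub x 1; rw [abs_one] at this
    linarith
  have hq0 : |(σ x).1| ≤ M := abs_fst_le_norm_boxRestrict hx0 σ
  have hq1 : |(σ (x + 1)).1| ≤ M := abs_fst_le_norm_boxRestrict hx1 σ
  have hqm1 : |(σ (x - 1)).1| ≤ M := abs_fst_le_norm_boxRestrict hxm1 σ
  have h1M : (1 : ℝ) ≤ 1 + M := by linarith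
  have hS3 : (1 + M) ≤ (1 + M) ^ 3 := by
    calc (1 + M) = (1 + M) ^ 1 := (pow_one _).symm
      _ ≤ (1 + M) ^ 3 := pow_le_pow_right₀ h1M (by norm_num)
  have hU : |ω₂ * (σ x).1 + lam * (σ x).1 ^ 3| ≤ (|ω₂| + |lam|) * (1 + M) ^ 3 := by
    have hq : |(σ x).1| ≤ 1 + M := by linarith
    calc |ω₂ * (σ x).1 + lam * (σ x).1 ^ 3| ≤ |ω₂| * |(σ x).1| + |lam| * |(σ x).1| ^ 3 := by
          refine (abs_add_le _ _).trans ?_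
          rw [abs_mul, abs_mul, abs_pow]
      _ ≤ |ω₂| * (1 + M) + |lam| * (1 + M) ^ 3 := by gcongr
      _ ≤ |ω₂| * (1 + M) ^ 3 + |lam| * (1 + M) ^ 3 := by gcongr
      _ = (|ω₂| + |lam|) * (1 + M) ^ 3 := by ring
  have hV1 := abs_pinnedChain_deriv_V_sub_le β hM hq1 hq0
  have hV2 := abs_pinnedChain_deriv_V_sub_le β hM hq0 hqm1
  rw [pinnedChain_force_eq]
  calc _ ≤ |-(ω₂ * (σ x).1 + lam * (σ x).1 ^ 3) +
          (((σ (x + 1)).1 - (σ x).1) + β * ((σ (x + 1)).1 - (σ x).1) ^ 3)| +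
          |((σ x).1 - (σ (x - 1)).1) + β * ((σ x).1 - (σ (x - 1)).1) ^ 3| := abs_sub _ _
    _ ≤ |ω₂ * (σ x).1 + lam * (σ x).1 ^ 3| +
          |((σ (x + 1)).1 - (σ x).1) + β * ((σ (x + 1)).1 - (σ x).1) ^ 3| +
          |((σ x).1 - (σ (x - 1)).1) + β * ((σ x).1 - (σ (x - 1)).1) ^ 3| := by
        gcongr
        refine (abs_add_le _ _).trans ?_
        rw [abs_neg]
    _ ≤ (|ω₂| + |lam|) * (1 + M) ^ 3 + (2 + 8 * |β|) * (1 + M) ^ 3 +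
          (2 + 8 * |β|) * (1 + M) ^ 3 := by gcongr
    _ = (|ω₂| + |lam| + 4 + 16 * |β|) * (1 + M) ^ 3 := by ring

/-- **Quartic growth of the bond current**: `|j_x(σ)| ≤ (2 + 8|β|) (1 + ‖box_R σ‖)⁴` for a box
containing `x, x + 1`. [folklore] -/
theorem abs_pinnedChain_bondCurrentZ_le {R : ℕ} {x : ℤ} (hx : |x| + 1 ≤ R) (σ : ChainConfig) :
    |(pinnedChain ω₂ lam β γ).bondCurrentZ σ x| ≤ (2 + 8 * |β|) * (1 + ‖boxRestrict R σ‖) ^ 4 := by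
  set M : ℝ := ‖boxRestrict R σ‖ with hMdef
  have hM : 0 ≤ M := norm_nonneg _
  have hx0 : |x| ≤ R := by linarith [abs_nonneg x]
  have hx1 : |x + 1| ≤ R := by
    have := abs_add_le x 1; rw [abs_one] at this
    linarith
  have hq0 : |(σ x).1| ≤ M := abs_fst_le_norm_boxRestrict hx0 σ
  have hq1 : |(σ (x + 1)).1| ≤ M := abs_fst_le_norm_boxRestrict hx1 σ
  have hp0 : |(σ x).2| ≤ M := abs_snd_le_norm_boxRestrict hx0 σ
  have hp1 : |(σ (x + 1)).2| ≤ M := abs_snd_le_norm_boxRestrict hx1 σ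
  have hV := abs_pinnedChain_deriv_V_sub_le β hM hq1 hq0
  have hp : |((σ x).2 + (σ (x + 1)).2) / 2| ≤ 1 + M := by
    rw [abs_div, abs_two]
    have := abs_add_le (σ x).2 (σ (x + 1)).2
    linarith
  rw [pinnedChain_bondCurrentZ_eq, abs_neg, abs_mul]
  calc _ ≤ (1 + M) * ((2 + 8 * |β|) * (1 + M) ^ 3) :=
        mul_le_mul hp hV (abs_nonneg _) (by positivity)
    _ = (2 + 8 * |β|) * (1 + M) ^ 4 := by ring

/-- **Cubic growth of `𝒜f` for `f ∈ C₀¹`** (pinned chain): `|𝒜f(σ)| ≤ K (1 + ‖box_R σ‖)³` for a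
suitable centred box. [folklore] -/
theorem exists_abs_liouvilleZ_le_growth {f : ChainConfig → ℝ} (hf : IsLocalTestFunction f) :
    ∃ (R : ℕ) (K : ℝ), 0 ≤ K ∧ ∀ σ : ChainConfig,
      |liouvilleZ (pinnedChain ω₂ lam β γ) f σ| ≤ K * (1 + ‖boxRestrict R σ‖) ^ 3 := by
  obtain ⟨R₀, C, hC, hle⟩ := hf.exists_abs_liouvilleZ_le (pinnedChain ω₂ lam β γ)
  refine ⟨R₀ + 1, C * ((2 * R₀ + 1) * (1 + (|ω₂| + |lam| + 4 + 16 * |β|))), by positivity,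
    fun σ => ?_⟩
  set M : ℝ := ‖boxRestrict (R₀ + 1) σ‖ with hMdef
  have hM : 0 ≤ M := norm_nonneg _
  have h1M : (1 : ℝ) ≤ 1 + M := by linarith
  have hS3 : (1 + M) ≤ (1 + M) ^ 3 := by
    calc (1 + M) = (1 + M) ^ 1 := (pow_one _).symm
      _ ≤ (1 + M) ^ 3 := pow_le_pow_right₀ h1M (by norm_num)
  have hterm : ∀ i : Fin (2 * R₀ + 1),
      |(σ ((i : ℤ) - R₀)).2| + |(pinnedChain ω₂ lam β γ).force σ ((i : ℤ) - R₀)| ≤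
        (1 + (|ω₂| + |lam| + 4 + 16 * |β|)) * (1 + M) ^ 3 := by
    intro i
    have hi := i.isLt
    have habs : |((i : ℤ) - R₀)| ≤ (R₀ : ℤ) := abs_le.mpr ⟨by omega, by omega⟩
    have hxi : |((i : ℤ) - R₀)| + 1 ≤ ((R₀ + 1 : ℕ) : ℤ) := by push_cast; linarith
    have hxi' : |((i : ℤ) - R₀)| ≤ ((R₀ + 1 : ℕ) : ℤ) := by push_cast; linarith
    have hp : |(σ ((i : ℤ) - R₀)).2| ≤ M := abs_snd_le_norm_boxRestrict hxi' σ
    have hF := abs_pinnedChain_force_le ω₂ lam β γ hxi σ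
    calc _ ≤ (1 + M) + (|ω₂| + |lam| + 4 + 16 * |β|) * (1 + M) ^ 3 := by
          gcongr; linarith
      _ ≤ (1 + M) ^ 3 + (|ω₂| + |lam| + 4 + 16 * |β|) * (1 + M) ^ 3 := by gcongr
      _ = (1 + (|ω₂| + |lam| + 4 + 16 * |β|)) * (1 + M) ^ 3 := by ring
  calc |liouvilleZ (pinnedChain ω₂ lam β γ) f σ|
        ≤ C * ∑ i : Fin (2 * R₀ + 1),
            (|(σ ((i : ℤ) - R₀)).2| + |(pinnedChain ω₂ lam β γ).force σ ((i : ℤ) - R₀)|) := hle σ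
    _ ≤ C * ∑ _i : Fin (2 * R₀ + 1), (1 + (|ω₂| + |lam| + 4 + 16 * |β|)) * (1 + M) ^ 3 := by
        gcongr with i
        exact hterm i
    _ = C * ((2 * R₀ + 1) * (1 + (|ω₂| + |lam| + 4 + 16 * |β|))) * (1 + M) ^ 3 := by
        rw [Finset.sum_const, Finset.card_univ, Fintype.card_fin, nsmul_eq_mul]
        push_cast
        ring

end PinnedChain

end Summit.AtomisticToContinuum.FouriersLaw.Theorems.CesaroUpgrade

end
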